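import Literature.Analysis.Convex.Subgradient
import Summits.Ventures.LatticeQCDFlow.Scaling.SwapLadderIndexTauIntTuning
import Summits.Ventures.LatticeQCDFlow.Scaling.SwapLadderIndexTauIntOptimumShape

/-!
HONEST FRAMING: exact (Metropolis-corrected) sampling algorithms for lattice gauge theory; figures
of merit are autocorrelation/cost numbers at stated couplings and volumes; no continuum-physics
claim.

# SwapLadderIndexTauIntOptimumUnique — STATIONARITY IS ALSO SUFFICIENT, AND THE `τ_int`-OPTIMAL LADDER IS UNIQUE:
# a positive gap vector minimises `Σ_j w_j²·G(ℓ_j)` at fixed total stiffness IFF `w_j²·G′(ℓ_j)` is the same for all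
# `j < K`, and two minimisers agree gap by gap (row 22 `su3-ptbc`, GEN-7, ours; sequel of
# `SwapLadderIndexTauIntOptimumShape`)

Venture `LatticeQCDFlow` (cell pub-lqcd), topic `Scaling`; FANOUT row 22 (`su3-ptbc`).  NEW WORK of the cell over
`SwapLadderIndexTauIntOptimumShape` (`gapIndexCost`, `gapSimplex`, `stationary_of_isMinOn`), GEN-6's
`SwapLadderRoundTripOptimum` (`strictConvexOn_gaussInvAcc`, `hasDerivAt_gaussInvAcc`, `deriv_gaussInvAcc`) and the
Literature first-order characterisation of convexity `ConvexOn.apply_add_fderiv_le` (Hiriart-Urruty–Lemaréchal,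
Chap. B Thm 4.1.1 — cited there, used here as a tool).  Nothing is cited as a fact; no `native_decide`.

* §0 `indexCost_eq_gapIndexCost` (`rfl`), `ladderOfGaps` (+ gaps / endpoints / strict monotonicity), **`isMinOn_ladderGap`** —
  a strictly increasing ladder minimising `indexCost` among the strictly increasing `K`-interval ladders with its endpoints
  has an index-optimal gap vector (the ladder reading of `SwapLadderIndexTauIntOptimumShape`).
* `gaussInvAcc_tangent_le` / `gaussInvAcc_tangent_lt` — the tangent line of `G = 1/erfc(·/(2√2))` lies below the
  graph, strictly away from the touching point (convexity / strict convexity).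
* **`isMinOn_of_stationary`** — `ℓ ∈ gapSimplex K Λ` and `w_j²·G′(ℓ_j) = μ` for all `j < K` ⇒ `ℓ` is index-optimal
  (KKT sufficiency for a convex objective with one linear constraint); with `stationary_of_isMinOn`:
  **`isMinOn_iff_stationary`**.
* **`eq_of_isMinOn`** — two index-optimal vectors of the same simplex agree on every `j < K` (strict convexity):
  the `τ_int`-optimal ladder, when it exists with positive gaps, is unique — so its mirror symmetry and monotone
  shape (`SwapLadderIndexTauIntOptimumShape`) describe THE optimum, not merely every optimum.

* EXISTENCE is settled separately (GEN-8): on the CLOSED simplex a minimiser always exists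
  (`SwapLadderIndexTauIntClosedSimplex.exists_isMinOn_closedGapSimplex`), and a POSITIVE index-optimal gap vector exists
  iff the total stiffness exceeds the threshold `Λ_c(K)` (`SwapLadderIndexTauIntThreshold.exists_isMinOn_gapSimplex_iff`);
  combined with this file: for `Λ > Λ_c(K)` THE `τ_int`-optimal ladder exists, is unique, and has the shape of
  `SwapLadderIndexTauIntOptimumShape`.

NOT CLAIMED: existence (see above — not imported here), a closed form, anything about PTBC or a run.
-/

noncomputable section

open Finset Real

namespace Summit.Ventures.LatticeQCDFlow.Scaling

/-! ## §0 Ladder reading: `indexCost K g = gapIndexCost K (ladderGap g)`; ladders from gap vectors -/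

section Ladder

variable {K : ℕ} {Λ : ℝ}

/-- `indexCost K g = gapIndexCost K (ladderGap g)`. [ours] -/
theorem indexCost_eq_gapIndexCost (K : ℕ) (g : ℕ → ℝ) : indexCost K g = gapIndexCost K (ladderGap g) := rfl

/-- The ladder with base `g₀` and gaps `ℓ`: `g_i = g₀ + Σ_{k<i} ℓ_k`. [ours] -/
def ladderOfGaps (g₀ : ℝ) (ℓ : ℕ → ℝ) (i : ℕ) : ℝ := g₀ + ∑ k ∈ range i, ℓ k

/-- Its gaps are `ℓ`. [ours] -/
theorem ladderGap_ladderOfGaps (g₀ : ℝ) (ℓ : ℕ → ℝ) (i : ℕ) : ladderGap (ladderOfGaps g₀ ℓ) i = ℓ i := by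
  simp [ladderGap, ladderOfGaps, sum_range_succ]

/-- Its base is `g₀`. [ours] -/
theorem ladderOfGaps_zero (g₀ : ℝ) (ℓ : ℕ → ℝ) : ladderOfGaps g₀ ℓ 0 = g₀ := by simp [ladderOfGaps]

/-- Its top is `g₀ + Σ_{k<K} ℓ_k`. [ours] -/
theorem ladderOfGaps_top (g₀ : ℝ) (ℓ : ℕ → ℝ) (K : ℕ) :
    ladderOfGaps g₀ ℓ K = g₀ + ∑ k ∈ range K, ℓ k := rfl

/-- A ladder is recovered from its base and gaps: `g_i = g_0 + Σ_{k<i} gap_k`. [ours] -/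
theorem ladderOfGaps_ladderGap (g : ℕ → ℝ) (i : ℕ) : ladderOfGaps (g 0) (ladderGap g) i = g i := by
  induction i with
  | zero => simp [ladderOfGaps]
  | succ n ih =>
    unfold ladderOfGaps at ih ⊢
    rw [sum_range_succ, ← add_assoc, ih]
    simp [ladderGap]

/-- Positive gaps give a strictly increasing ladder. [ours] -/
theorem strictMono_ladderOfGaps (g₀ : ℝ) {ℓ : ℕ → ℝ} (hℓ : ∀ k, 0 < ℓ k) : StrictMono (ladderOfGaps g₀ ℓ) :=
  strictMono_nat_of_lt_succ fun n => by
    have := hℓ n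
    simp only [ladderOfGaps, sum_range_succ]
    linarith

/-- INDEX-OPTIMAL means: `ℓ ∈ gapSimplex K Λ` and `IsMinOn (gapIndexCost K) (gapSimplex K Λ) ℓ` (Mathlib).  LADDER
READING: a strictly increasing ladder minimising `indexCost` among the strictly increasing `K`-interval ladders with
its endpoints has an index-optimal gap vector. [ours] -/
theorem isMinOn_ladderGap {g : ℕ → ℝ} (hg : StrictMono g)
    (hmin : ∀ g' : ℕ → ℝ, StrictMono g' → g' 0 = g 0 → g' K = g K → indexCost K g ≤ indexCost K g') :
    ladderGap g ∈ gapSimplex K (g K - g 0) ∧ IsMinOn (gapIndexCost K) (gapSimplex K (g K - g 0)) (ladderGap g) := by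
  have hsum : ∑ k ∈ range K, ladderGap g k = g K - g 0 := by
    have := ladderOfGaps_ladderGap g K
    rw [ladderOfGaps_top] at this
    linarith
  refine ⟨⟨fun k _ => sub_pos.mpr (hg (Nat.lt_succ_self k)), hsum⟩, isMinOn_iff.mpr fun ℓ' hℓ' => ?_⟩
  obtain ⟨hℓ'pos, hℓ'sum⟩ := hℓ'
  -- extend `ℓ'` by positive gaps beyond `K` so that the rebuilt ladder is strictly increasing everywhere
  let ℓ'' : ℕ → ℝ := fun k => if k < K then ℓ' k else 1
  have hℓ'' : ∀ k, 0 < ℓ'' k := fun k => by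
    by_cases hk : k < K
    · simp only [ℓ'', hk, if_true]; exact hℓ'pos k hk
    · simp only [ℓ'', hk, if_false]; exact one_pos
  have hagree : ∀ k ∈ range K, ℓ'' k = ℓ' k := fun k hk => by simp [ℓ'', mem_range.mp hk]
  have hcost : gapIndexCost K ℓ'' = gapIndexCost K ℓ' :=
    sum_congr rfl fun k hk => by rw [hagree k hk]
  have htop : ladderOfGaps (g 0) ℓ'' K = g K := by
    rw [ladderOfGaps_top, sum_congr rfl hagree, hℓ'sum]; ring
  have h := hmin (ladderOfGaps (g 0) ℓ'') (strictMono_ladderOfGaps (g 0) hℓ'') (ladderOfGaps_zero _ _) htop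
  rw [indexCost_eq_gapIndexCost, indexCost_eq_gapIndexCost] at h
  have e : ladderGap (ladderOfGaps (g 0) ℓ'') = ℓ'' := funext fun k => ladderGap_ladderOfGaps _ _ k
  rwa [e, hcost] at h

end Ladder

/-! ## §1 Tangent lines of `G` -/

section Tangent

/-- **Convexity, first order: `G x + G′(x)·(y − x) ≤ G y`.** [ours] -/
theorem gaussInvAcc_tangent_le (x y : ℝ) : gaussInvAcc x + deriv gaussInvAcc x * (y - x) ≤ gaussInvAcc y := by
  have hd : HasDerivAt gaussInvAcc (deriv gaussInvAcc x) x :=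
    (hasDerivAt_gaussInvAcc x).differentiableAt.hasDerivAt
  have h := Literature.Analysis.Convex.ConvexOn.apply_add_fderiv_le strictConvexOn_gaussInvAcc.convexOn
    (Set.mem_univ x) hd.hasFDerivAt (Set.mem_univ y)
  simpa [ContinuousLinearMap.smulRight_apply, mul_comm] using h

/-- **Strict convexity, first order: `G x + G′(x)·(y − x) < G y` for `y ≠ x`** (tangent inequality at the
midpoint + strict midpoint convexity). [ours] -/
theorem gaussInvAcc_tangent_lt {x y : ℝ} (hxy : x ≠ y) :
    gaussInvAcc x + deriv gaussInvAcc x * (y - x) < gaussInvAcc y := by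
  have hm := gaussInvAcc_tangent_le x ((x + y) / 2)
  have hs := strictConvexOn_gaussInvAcc.2 (Set.mem_univ x) (Set.mem_univ y) hxy
    (show (0 : ℝ) < 1 / 2 by norm_num) (show (0 : ℝ) < 1 / 2 by norm_num) (by norm_num)
  simp only [smul_eq_mul] at hs
  have e : (1 / 2 : ℝ) * x + 1 / 2 * y = (x + y) / 2 := by ring
  rw [e] at hs
  linarith

end Tangent

/-! ## §2 Stationarity is sufficient; the characterisation -/

section Sufficient

variable {K : ℕ} {Λ : ℝ} {ℓ : ℕ → ℝ}

/-- **KKT SUFFICIENCY: a feasible positive gap vector with `w_j²·G′(ℓ_j) = μ` for all `j < K` is index-optimal.**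
For any feasible `ℓ'`: `cost ℓ' − cost ℓ ≥ Σ_j w_j²·G′(ℓ_j)(ℓ'_j − ℓ_j) = μ·(Λ − Λ) = 0`. [ours] -/
theorem isMinOn_of_stationary (hℓ : ℓ ∈ gapSimplex K Λ) {μ : ℝ}
    (hstat : ∀ j, j < K → passageWeight K j ^ 2 * deriv gaussInvAcc (ℓ j) = μ) :
    IsMinOn (gapIndexCost K) (gapSimplex K Λ) ℓ := by
  refine isMinOn_iff.mpr fun ℓ' hℓ' => ?_
  unfold gapIndexCost
  have hterm : ∀ j ∈ range K, passageWeight K j ^ 2 * gaussInvAcc (ℓ j) + μ * (ℓ' j - ℓ j)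
      ≤ passageWeight K j ^ 2 * gaussInvAcc (ℓ' j) := by
    intro j hj
    have ht := gaussInvAcc_tangent_le (ℓ j) (ℓ' j)
    have hw : 0 ≤ passageWeight K j ^ 2 := sq_nonneg _
    have := mul_le_mul_of_nonneg_left ht hw
    rw [← hstat j (mem_range.mp hj)]
    nlinarith
  have hsum := sum_le_sum hterm
  rw [sum_add_distrib, ← mul_sum, sum_sub_distrib, hℓ'.2, hℓ.2, sub_self, mul_zero, add_zero] at hsum
  exact hsum

/-- **CHARACTERISATION: a positive gap vector of the simplex is index-optimal iff `w_j²·G′(ℓ_j)` is constant in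
`j < K`.** [ours] -/
theorem isMinOn_iff_stationary (hℓ : ℓ ∈ gapSimplex K Λ) :
    IsMinOn (gapIndexCost K) (gapSimplex K Λ) ℓ ↔
      ∃ μ : ℝ, ∀ j, j < K → passageWeight K j ^ 2 * deriv gaussInvAcc (ℓ j) = μ := by
  constructor
  · intro hmin
    rcases Nat.eq_zero_or_pos K with hK | hK
    · exact ⟨0, fun j hj => by omega⟩
    · exact ⟨passageWeight K 0 ^ 2 * deriv gaussInvAcc (ℓ 0), fun j hj => stationary_of_isMinOn hℓ hmin hj hK⟩
  · rintro ⟨μ, hstat⟩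
    exact isMinOn_of_stationary hℓ hstat

end Sufficient

/-! ## §3 Uniqueness -/

section Unique

variable {K : ℕ} {Λ : ℝ} {ℓ ℓ' : ℕ → ℝ}

/-- **UNIQUENESS: two index-optimal positive gap vectors of the same simplex agree on every `j < K`.** [ours] -/
theorem eq_of_isMinOn (hℓ : ℓ ∈ gapSimplex K Λ) (hmin : IsMinOn (gapIndexCost K) (gapSimplex K Λ) ℓ)
    (hℓ' : ℓ' ∈ gapSimplex K Λ) (hmin' : IsMinOn (gapIndexCost K) (gapSimplex K Λ) ℓ') {j : ℕ} (hj : j < K) :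
    ℓ j = ℓ' j := by
  by_contra hne
  have hK : 0 < K := by omega
  -- stationarity of `ℓ`
  set μ := passageWeight K 0 ^ 2 * deriv gaussInvAcc (ℓ 0) with hμ
  have hstat : ∀ i, i < K → passageWeight K i ^ 2 * deriv gaussInvAcc (ℓ i) = μ := fun i hi =>
    stationary_of_isMinOn hℓ hmin hi hK
  -- every term of `cost ℓ' − cost ℓ − μ·(Σℓ' − Σℓ)` is ≥ 0, the `j`-th one is > 0
  have hterm : ∀ i ∈ range K, passageWeight K i ^ 2 * gaussInvAcc (ℓ i) + μ * (ℓ' i - ℓ i)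
      ≤ passageWeight K i ^ 2 * gaussInvAcc (ℓ' i) := by
    intro i hi
    have ht := gaussInvAcc_tangent_le (ℓ i) (ℓ' i)
    have hw : 0 ≤ passageWeight K i ^ 2 := sq_nonneg _
    have := mul_le_mul_of_nonneg_left ht hw
    rw [← hstat i (mem_range.mp hi)]
    nlinarith
  have hstrict : passageWeight K j ^ 2 * gaussInvAcc (ℓ j) + μ * (ℓ' j - ℓ j)
      < passageWeight K j ^ 2 * gaussInvAcc (ℓ' j) := by
    have ht := gaussInvAcc_tangent_lt hne
    have hw : 0 < passageWeight K j ^ 2 := pow_pos (passageWeight_pos hj) 2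
    have := mul_lt_mul_of_pos_left ht hw
    rw [← hstat j hj]
    nlinarith
  have hsum := sum_lt_sum hterm ⟨j, mem_range.mpr hj, hstrict⟩
  rw [sum_add_distrib, ← mul_sum, sum_sub_distrib, hℓ'.2, hℓ.2, sub_self, mul_zero, add_zero] at hsum
  -- but `ℓ'` is optimal too: `cost ℓ' ≤ cost ℓ`
  have hle : gapIndexCost K ℓ' ≤ gapIndexCost K ℓ := isMinOn_iff.mp hmin' ℓ hℓ
  unfold gapIndexCost at hle
  linarith

/-- Ladder form: two `indexCost`-optimal strictly increasing `K`-interval ladders with the same endpoints coincide on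
`0, …, K`. [ours] -/
theorem ladder_eq_of_isMinOn {g g' : ℕ → ℝ} (hg : ladderGap g ∈ gapSimplex K Λ)
    (hmin : IsMinOn (gapIndexCost K) (gapSimplex K Λ) (ladderGap g)) (hg' : ladderGap g' ∈ gapSimplex K Λ)
    (hmin' : IsMinOn (gapIndexCost K) (gapSimplex K Λ) (ladderGap g')) (h0 : g 0 = g' 0) {i : ℕ} (hi : i ≤ K) :
    g i = g' i := by
  induction i with
  | zero => exact h0
  | succ n ih =>
    have hgap := eq_of_isMinOn hg hmin hg' hmin' (show n < K by omega)
    unfold ladderGap at hgap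
    have := ih (by omega)
    linarith

end Unique


end Summit.Ventures.LatticeQCDFlow.Scaling

end
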